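import Summits.AtomisticToContinuum.HydrodynamicLimit.Theorems.TwoClocksEquilibriumFastWindowLDBirthT12CircleLegendre
import HarnessLib

/-!
# Iterated zonal operators: `j` far-field steps as a `j`-fold iterated circle average, and the Legendre
# coefficients of the `j`-fold iterate
# (helpers `t12_iterate_zonal_eq_iterate_circleAvg`, `t12_iterate_zonal_legendre` of the line `birth`, crux
# `TwoClocks.EquilibriumFastWindowLD`, stmt-AtomisticToContinuum-14440; §6 FF2-infrastructure towards the
# registered analytic sub-goal `t12_logLinearPreimage_and_dipoleModulus`)

Plan §6 FF2 of the sub-goal asks for the `k`-FOLD far-field iterate "as an average of compositions of circle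
averages": one normalised far-field step on the linear-growth class is the zonal operator
`(T Y)(n) = (2/π) ∫_{S²} ⟪n, ω⟫₊² Y(ω) dσ(ω) = ∫₀¹ 4ρ² (A_ρ Y)(n) dρ` (`lorentzGain_smul_of_linear`, FACT F of
`…T12LorentzCircleAvg`; `(A_z Y)(n) = (2π)⁻¹ ∫_{-π}^{π} Y(z n + √(1-z²)(cos φ e₁ n + sin φ e₂ n)) dφ`), and `j` steps
should read `∫⋯∫ Π 4ρ_i² dρ_i (A_{ρ_1} ∘ ⋯ ∘ A_{ρ_j} Y)(n)`. The two-step case is `integral_sphere_zonal_zonal_eq_cyl`;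
here the general case is done by induction, for an arbitrary zonal weight `k`, with the operators written as
iterates `K^[j]`, `C^[j]` of explicit lambda terms (NO new definition):

* `measurable_iterate_sphere_zonal`, `abs_iterate_sphere_zonal_le` — `K^j Y` is measurable and bounded by
  `(2π‖k‖₁)^j m` on the sphere (the hypotheses of Funk–Hecke for circles propagate);
* **`iterate_sphere_zonal_eq_iterate_cyl`** (registered `t12_iterate_zonal_eq_iterate_circleAvg`) — for unit `n`:
  `(K^j Y)(n) = (C^j Y)(n)`, `(K F)(x) = ∫ k(⟪x, ω⟫) F(ω) dσ(ω)`,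
  `(C F)(x) = ∫_{-1}^{1} k(z) ∫_{-π}^{π} F(z x + √(1-z²)(cos φ e₁ x + sin φ e₂ x)) dφ dz = 2π ∫ k(z) (A_z F)(x) dz`;
* `cylStep_posPartSq_eq`, **`iterate_farFieldStep_eq_iterate_circleAvg`** — the specialisation `k = (2/π)x₊²`
  in the plan's form `(T^j Y)(n) = ∫₀¹4ρ₁² A_{ρ₁}(⋯ ∫₀¹4ρ_j² A_{ρ_j} Y ⋯)(n)` (law `Π 4ρ_i² dρ_i`);
* `lorentzGain_smul_of_linear_eq_farFieldStep` — the identification with the Lorentz gain operator of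
  `…T12Lorentz*`: on `u(r x) = r Y(x)`, `lorentzGain u (s n) = πs · s · (T Y)(n)`; `farFieldStep_legendreCoeff`,
  `abs_farFieldStep_legendreCoeff_le` — the one-step Legendre coefficients `λ_ℓ = 4∫₀¹ z² P_ℓ(z) dz` of `T`
  (`λ_ℓ(1)` of `…T12Indicial`) and `|λ_ℓ| ≤ μ_ℓ = 4∫₀¹ z² |P_ℓ|` (`…T12Legendre`);
* **`iterate_sphere_zonal_legendre`** (registered `t12_iterate_zonal_legendre`) — on the zonal harmonics the
  iterate is diagonal with the PRODUCT of the one-step Legendre coefficients: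
  `(K^j P_ℓ(⟪n', ·⟫))(n) = λ_ℓ(k)^j P_ℓ(⟪n, n'⟫)`, `λ_ℓ(k) = 2π ∫_{-1}^{1} k P_ℓ` (Funk–Hecke
  `integral_sphere_zonal_mul_legendre` of the sibling file, iterated) — the "`Π_i P_ℓ(ρ_i)`" of FF4: for
  `k = (2/π)x₊²`, `λ_ℓ = ∫₀¹ 4ρ² P_ℓ(ρ) dρ`, `|λ_ℓ| ≤ μ_ℓ` of `…T12Legendre`.

All statements are [folklore] (Funk 1916 / Hecke 1918; spherical convolution of zonal kernels).
-/

noncomputable section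

open MeasureTheory Real Set Filter Metric Polynomial
open scoped ENNReal BigOperators InnerProductSpace
namespace Summit.AtomisticToContinuum.HydrodynamicLimit.Theorems.ClampedCorrectorBirth

open Literature.Analysis.FluidPDE Literature.MathematicalPhysics.KineticTheory
  Literature.Analysis.SpecialFunctions

/-! ### Iterated zonal operators (FF2): `k` steps as iterated circle averages -/

/-- Iterates of a zonal operator `(K F)(x) = ∫ k(⟪x, ω⟫) F(ω) dσ(ω)` applied to a measurable profile are
measurable. [folklore] -/
theorem measurable_iterate_sphere_zonal {k : ℝ → ℝ} (hk : Measurable k) {Y : EuclideanSpace ℝ (Fin 3) → ℝ}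
    (hY : Measurable Y) (j : ℕ) :
    Measurable ((fun (F : EuclideanSpace ℝ (Fin 3) → ℝ) (x : EuclideanSpace ℝ (Fin 3)) =>
      ∫ ω : sphere (0 : EuclideanSpace ℝ (Fin 3)) 1, k ⟪x, (ω : EuclideanSpace ℝ (Fin 3))⟫_ℝ * F ω ∂sphereMeasure)^[j] Y) := by
  induction j with
  | zero => exact hY
  | succ j ih =>
    rw [Function.iterate_succ_apply']
    exact measurable_integral_sphere_zonal_mul hk ih

/-- Iterates of a zonal operator on a bounded profile are bounded on the unit sphere:
`|K^j Y| ≤ (2π ‖k‖_{L¹[-1,1]})^j m`. [folklore] -/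
theorem abs_iterate_sphere_zonal_le {k : ℝ → ℝ} (hkI : IntervalIntegrable k volume (-1) 1)
    {Y : EuclideanSpace ℝ (Fin 3) → ℝ} {m : ℝ} (hm : ∀ x : EuclideanSpace ℝ (Fin 3), ‖x‖ = 1 → |Y x| ≤ m) (j : ℕ) :
    ∀ x : EuclideanSpace ℝ (Fin 3), ‖x‖ = 1 →
      |((fun (F : EuclideanSpace ℝ (Fin 3) → ℝ) (x : EuclideanSpace ℝ (Fin 3)) =>
        ∫ ω : sphere (0 : EuclideanSpace ℝ (Fin 3)) 1, k ⟪x, (ω : EuclideanSpace ℝ (Fin 3))⟫_ℝ * F ω ∂sphereMeasure)^[j] Y) x| ≤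
        (2 * π * ∫ t in (-1:ℝ)..1, |k t|) ^ j * m := by
  induction j with
  | zero => intro x hx; simpa using hm x hx
  | succ j ih =>
    intro x hx
    rw [Function.iterate_succ_apply', pow_succ, mul_comm (_ ^ j), mul_assoc]
    exact abs_integral_sphere_zonal_mul_le hx hkI ih

/-- **FF2 — `j` zonal steps as a `j`-fold iterated circle average.** For unit `n`, a zonal weight `k`
(measurable, integrable on `[-1, 1]`) and a bounded measurable profile `Y`, the `j`-th iterate of the zonal
operator `(K F)(x) = ∫_{S²} k(⟪x, ω⟫) F(ω) dσ(ω)` at `n` equals the `j`-th iterate of the cylindrical step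
`(C F)(x) = ∫_{-1}^{1} k(z) ∫_{-π}^{π} F(z x + √(1-z²)(cos φ e₁ x + sin φ e₂ x)) dφ dz = 2π ∫ k(z) (A_z F)(x) dz` at `n`:
`(K^j Y)(n) = (C^j Y)(n) = (2π)^j ∫⋯∫ Π k(z_i) (A_{z_1} ∘ ⋯ ∘ A_{z_j} Y)(n) dz` — the `j`-fold far-field iterate
"as an average of compositions of circle averages" (with `k = (2/π) x₊²`: the normalised one-step
operator of plan §6 on the linear-growth class, radius-ratio law `4ρ² dρ`; `k = (2/π) x₊`: direction-only
data, law `4ρ dρ`). Induction on `j` with Funk–Hecke for circles. [folklore] -/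
theorem iterate_sphere_zonal_eq_iterate_cyl {n : EuclideanSpace ℝ (Fin 3)} (hn : ‖n‖ = 1) {k : ℝ → ℝ}
    (hk : Measurable k) (hkI : IntervalIntegrable k volume (-1) 1) {Y : EuclideanSpace ℝ (Fin 3) → ℝ}
    (hY : Measurable Y) {m : ℝ} (hm : ∀ x : EuclideanSpace ℝ (Fin 3), ‖x‖ = 1 → |Y x| ≤ m) (j : ℕ) :
    ((fun (F : EuclideanSpace ℝ (Fin 3) → ℝ) (x : EuclideanSpace ℝ (Fin 3)) =>
        ∫ ω : sphere (0 : EuclideanSpace ℝ (Fin 3)) 1, k ⟪x, (ω : EuclideanSpace ℝ (Fin 3))⟫_ℝ * F ω ∂sphereMeasure)^[j]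
        Y) n =
      ((fun (F : EuclideanSpace ℝ (Fin 3) → ℝ) (x : EuclideanSpace ℝ (Fin 3)) =>
        ∫ z in (-1:ℝ)..1, k z * ∫ φ in (-π)..π,
          F (z • x + √(1 - z ^ 2) • (cos φ • Lambert.e₁ x + sin φ • Lambert.e₂ x)))^[j] Y) n := by
  induction j generalizing n with
  | zero => rfl
  | succ j ih =>
    rw [Function.iterate_succ_apply', Function.iterate_succ_apply',
      integral_sphere_zonal_mul_eq_intervalIntegral hn hk (measurable_iterate_sphere_zonal hk hY j)
        (integrable_sphere_zonal_mul hn hkI (measurable_iterate_sphere_zonal hk hY j)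
          (abs_iterate_sphere_zonal_le hkI hm j))]
    refine intervalIntegral.integral_congr fun z hz => ?_
    rw [uIcc_of_le (by norm_num)] at hz
    congr 1
    refine intervalIntegral.integral_congr fun φ _ => ?_
    exact ih (norm_cylPoint hn (by nlinarith [hz.1, hz.2]) φ)

/-- **Legendre coefficients of the `j`-fold iterate multiply**: for unit `n, n'`, a zonal weight `k`
(measurable, integrable on `[-1, 1]`) and every `ℓ, j`,
`(K^j P_ℓ(⟪n', ·⟫))(n) = λ_ℓ(k)^j P_ℓ(⟪n, n'⟫)`, `λ_ℓ(k) = 2π ∫_{-1}^{1} k P_ℓ` — the `j`-fold spherical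
convolution of zonal kernels has `ℓ`-th Legendre coefficient `λ_ℓ^j` (plan §6 FF4: with the one-step law this
is `Π_i P_ℓ(ρ_i)` averaged). [folklore] -/
theorem iterate_sphere_zonal_legendre (ℓ : ℕ) {n' : EuclideanSpace ℝ (Fin 3)} (hn' : ‖n'‖ = 1) {k : ℝ → ℝ}
    (hk : Measurable k) (hkI : IntervalIntegrable k volume (-1) 1) (j : ℕ) {n : EuclideanSpace ℝ (Fin 3)}
    (hn : ‖n‖ = 1) :
    ((fun (F : EuclideanSpace ℝ (Fin 3) → ℝ) (x : EuclideanSpace ℝ (Fin 3)) =>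
        ∫ ω : sphere (0 : EuclideanSpace ℝ (Fin 3)) 1, k ⟪x, (ω : EuclideanSpace ℝ (Fin 3))⟫_ℝ * F ω ∂sphereMeasure)^[j]
        (fun x => (legendre ℓ).eval ⟪n', x⟫_ℝ)) n =
      (2 * π * ∫ z in (-1:ℝ)..1, k z * (legendre ℓ).eval z) ^ j * (legendre ℓ).eval ⟪n, n'⟫_ℝ := by
  induction j generalizing n with
  | zero => simp [real_inner_comm n n']
  | succ j ih =>
    rw [Function.iterate_succ_apply']
    have h : ∀ ω : sphere (0 : EuclideanSpace ℝ (Fin 3)) 1,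
        k ⟪n, (ω : EuclideanSpace ℝ (Fin 3))⟫_ℝ * ((fun (F : EuclideanSpace ℝ (Fin 3) → ℝ) (x : EuclideanSpace ℝ (Fin 3)) =>
          ∫ ω : sphere (0 : EuclideanSpace ℝ (Fin 3)) 1, k ⟪x, (ω : EuclideanSpace ℝ (Fin 3))⟫_ℝ * F ω ∂sphereMeasure)^[j]
          (fun x => (legendre ℓ).eval ⟪n', x⟫_ℝ)) ω =
        (2 * π * ∫ z in (-1:ℝ)..1, k z * (legendre ℓ).eval z) ^ j *
          (k ⟪n, (ω : EuclideanSpace ℝ (Fin 3))⟫_ℝ * (legendre ℓ).eval ⟪n', (ω : EuclideanSpace ℝ (Fin 3))⟫_ℝ) :=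
      fun ω => by rw [ih (by simp), real_inner_comm n']; ring
    rw [integral_congr_ae (Eventually.of_forall h), integral_const_mul,
      integral_sphere_zonal_mul_legendre ℓ hn hn' hk hkI]
    ring

/-! ### The normalised far-field step `(2/π) x₊²` -/

/-- The cylindrical step of the normalised far-field operator on the linear-growth class, in the
`4ρ² dρ · A_ρ` form of plan §6: for every `F` and `x`,
`∫_{-1}^{1} (2/π) z₊² ∫_{-π}^{π} F(c_z(φ)) dφ dz = ∫₀¹ 4z² · (2π)⁻¹∫_{-π}^{π} F(c_z(φ)) dφ dz` (radius-ratio law `4ρ² dρ`,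
mass `4/3 = λ₀(1)`; no integrability needed). [folklore] -/
theorem cylStep_posPartSq_eq (F : EuclideanSpace ℝ (Fin 3) → ℝ) (x : EuclideanSpace ℝ (Fin 3)) :
    ∫ z in (-1:ℝ)..1, 2 / π * max z 0 ^ 2 * ∫ φ in (-π)..π,
        F (z • x + √(1 - z ^ 2) • (cos φ • Lambert.e₁ x + sin φ • Lambert.e₂ x)) =
      ∫ z in (0:ℝ)..1, 4 * z ^ 2 * ((2 * π)⁻¹ * ∫ φ in (-π)..π,
        F (z • x + √(1 - z ^ 2) • (cos φ • Lambert.e₁ x + sin φ • Lambert.e₂ x))) := by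
  rw [intervalIntegral.integral_of_le (by norm_num), intervalIntegral.integral_of_le zero_le_one,
    setIntegral_eq_of_subset_of_forall_sdiff_eq_zero (s := Ioc (0:ℝ) 1) measurableSet_Ioc
      (Ioc_subset_Ioc (by norm_num) le_rfl) (fun z hz => ?_)]
  · refine setIntegral_congr_fun measurableSet_Ioc fun z hz => ?_
    rw [max_eq_left hz.1.le]
    field_simp
    ring
  · have hz0 : z ≤ 0 := le_of_not_gt fun h => hz.2 ⟨h, hz.1.2⟩
    simp [max_eq_right hz0]

/-- **FF2 for the normalised far-field step on the linear-growth class** (`k = (2/π) x₊²`, the operator `T`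
of plan §6 after division by `ν ≈ πs` and the weight `s`; `lorentzGain_smul_of_linear`): for unit `n` and a
bounded measurable profile `Y`,
`(T^j Y)(n) = ∫₀¹4ρ₁² A_{ρ₁}( ⋯ ∫₀¹4ρ_j² A_{ρ_j} Y ⋯ )(n) dρ` — `j` far-field collisions multiply the radius by
`ρ₁⋯ρ_j` (law `Π 4ρ_i² dρ_i`) and compose the circle averages `A_{ρ_1} ∘ ⋯ ∘ A_{ρ_j}`. [folklore] -/
theorem iterate_farFieldStep_eq_iterate_circleAvg {n : EuclideanSpace ℝ (Fin 3)} (hn : ‖n‖ = 1)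
    {Y : EuclideanSpace ℝ (Fin 3) → ℝ} (hY : Measurable Y) {m : ℝ}
    (hm : ∀ x : EuclideanSpace ℝ (Fin 3), ‖x‖ = 1 → |Y x| ≤ m) (j : ℕ) :
    ((fun (F : EuclideanSpace ℝ (Fin 3) → ℝ) (x : EuclideanSpace ℝ (Fin 3)) =>
        ∫ ω : sphere (0 : EuclideanSpace ℝ (Fin 3)) 1,
          2 / π * max ⟪x, (ω : EuclideanSpace ℝ (Fin 3))⟫_ℝ 0 ^ 2 * F ω ∂sphereMeasure)^[j] Y) n =
      ((fun (F : EuclideanSpace ℝ (Fin 3) → ℝ) (x : EuclideanSpace ℝ (Fin 3)) =>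
        ∫ z in (0:ℝ)..1, 4 * z ^ 2 * ((2 * π)⁻¹ * ∫ φ in (-π)..π,
          F (z • x + √(1 - z ^ 2) • (cos φ • Lambert.e₁ x + sin φ • Lambert.e₂ x))))^[j] Y) n := by
  have hk : Measurable fun z : ℝ => 2 / π * max z 0 ^ 2 :=
    measurable_const.mul ((measurable_id.max measurable_const).pow_const 2)
  have hkI : IntervalIntegrable (fun z : ℝ => 2 / π * max z 0 ^ 2) volume (-1) 1 :=
    (by fun_prop : Continuous fun z : ℝ => 2 / π * max z 0 ^ 2).intervalIntegrable _ _
  have h := iterate_sphere_zonal_eq_iterate_cyl hn hk hkI hY hm j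
  have hstep : (fun (F : EuclideanSpace ℝ (Fin 3) → ℝ) (x : EuclideanSpace ℝ (Fin 3)) =>
      ∫ z in (-1:ℝ)..1, 2 / π * max z 0 ^ 2 * ∫ φ in (-π)..π,
        F (z • x + √(1 - z ^ 2) • (cos φ • Lambert.e₁ x + sin φ • Lambert.e₂ x))) =
      fun (F : EuclideanSpace ℝ (Fin 3) → ℝ) (x : EuclideanSpace ℝ (Fin 3)) =>
        ∫ z in (0:ℝ)..1, 4 * z ^ 2 * ((2 * π)⁻¹ * ∫ φ in (-π)..π,
          F (z • x + √(1 - z ^ 2) • (cos φ • Lambert.e₁ x + sin φ • Lambert.e₂ x))) :=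
    funext fun F => funext fun x => cylStep_posPartSq_eq F x
  rw [h, hstep]

/-! ### The link with the Lorentz gain operator and the one-step Legendre coefficients -/

/-- **One far-field collision step on the linear-growth class is the zonal operator `(2/π) x₊²` on profiles**:
for `u(r x) = r Y(x)` (`r > 0`, `‖x‖ = 1`), `0 ≤ s` and any `n`,
`lorentzGain u (s n) = πs · s · ∫_{S²} (2/π)⟪n, ω⟫₊² Y(ω) dσ(ω)` — after division by `ν ≈ πs` the image is again of
linear growth, with profile `T Y = ∫ (2/π)⟪·, ω⟫₊² Y(ω) dσ(ω)` (`lorentzGain_smul_of_linear` rearranged); iterating,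
`j` steps act on the profile by `T^j` (`iterate_farFieldStep_eq_iterate_circleAvg`). [folklore] -/
theorem lorentzGain_smul_of_linear_eq_farFieldStep {u : EuclideanSpace ℝ (Fin 3) → ℝ} {n : EuclideanSpace ℝ (Fin 3)}
    {s : ℝ} (hs : 0 ≤ s) (hu : Measurable u) {Y : EuclideanSpace ℝ (Fin 3) → ℝ}
    (hsep : ∀ (r : ℝ) (x : EuclideanSpace ℝ (Fin 3)), 0 < r → ‖x‖ = 1 → u (r • x) = r * Y x) :
    lorentzGain u (s • n) = π * s * (s * ∫ ω : sphere (0 : EuclideanSpace ℝ (Fin 3)) 1,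
      2 / π * max ⟪n, (ω : EuclideanSpace ℝ (Fin 3))⟫_ℝ 0 ^ 2 * Y ω ∂sphereMeasure) := by
  rw [lorentzGain_smul_of_linear hs hu hsep]
  simp_rw [mul_assoc (2 / π)]
  rw [integral_const_mul]
  field_simp

/-- **The Legendre coefficients of the normalised far-field step**:
`2π ∫_{-1}^{1} (2/π) z₊² P_ℓ(z) dz = 4 ∫₀¹ z² P_ℓ(z) dz` (`= λ_ℓ(1)` of `…T12Indicial`: `4/3, 1, 8/15, 1/6, 0, -1/48, …`).
[folklore] -/
theorem farFieldStep_legendreCoeff (ℓ : ℕ) :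
    2 * π * ∫ z in (-1:ℝ)..1, 2 / π * max z 0 ^ 2 * (legendre ℓ).eval z =
      4 * ∫ z in (0:ℝ)..1, z ^ 2 * (legendre ℓ).eval z := by
  have hI : ∀ a b : ℝ, IntervalIntegrable (fun z : ℝ => 2 / π * max z 0 ^ 2 * (legendre ℓ).eval z) volume a b :=
    fun a b => ((by fun_prop : Continuous fun z : ℝ => 2 / π * max z 0 ^ 2).mul
      (legendre ℓ).continuous).intervalIntegrable _ _
  have h0 : ∫ z in (-1:ℝ)..0, 2 / π * max z 0 ^ 2 * (legendre ℓ).eval z = 0 := by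
    refine (intervalIntegral.integral_congr (g := fun _ => (0:ℝ)) fun z hz => ?_).trans
      intervalIntegral.integral_zero
    rw [uIcc_of_le (by norm_num)] at hz
    simp [max_eq_right hz.2]
  have h1 : ∫ z in (0:ℝ)..1, 2 / π * max z 0 ^ 2 * (legendre ℓ).eval z =
      2 / π * ∫ z in (0:ℝ)..1, z ^ 2 * (legendre ℓ).eval z := by
    rw [← intervalIntegral.integral_const_mul]
    refine intervalIntegral.integral_congr fun z hz => ?_
    rw [uIcc_of_le zero_le_one] at hz
    simp only [max_eq_left hz.1, mul_assoc]
  rw [← intervalIntegral.integral_add_adjacent_intervals (b := 0) (hI _ _) (hI _ _), h0, zero_add, h1]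
  field_simp
  ring

/-- `|λ_ℓ| ≤ μ_ℓ`: the Legendre coefficients of the normalised far-field step are bounded by the one-step
constants `μ_ℓ = 4∫₀¹ ρ² |P_ℓ(ρ)| dρ` of `…T12Legendre` (`μ₂ = 8/15 + 8√3/135`, `μ_ℓ ≤ 4/√(5(2ℓ+1))`). [folklore] -/
theorem abs_farFieldStep_legendreCoeff_le (ℓ : ℕ) :
    |2 * π * ∫ z in (-1:ℝ)..1, 2 / π * max z 0 ^ 2 * (legendre ℓ).eval z| ≤
      4 * ∫ z in (0:ℝ)..1, z ^ 2 * |(legendre ℓ).eval z| := by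
  rw [farFieldStep_legendreCoeff, abs_mul, abs_of_pos four_pos]
  refine mul_le_mul_of_nonneg_left ?_ (by norm_num)
  calc |∫ z in (0:ℝ)..1, z ^ 2 * (legendre ℓ).eval z|
      ≤ ∫ z in (0:ℝ)..1, |z ^ 2 * (legendre ℓ).eval z| :=
        intervalIntegral.abs_integral_le_integral_abs zero_le_one
    _ = ∫ z in (0:ℝ)..1, z ^ 2 * |(legendre ℓ).eval z| :=
        intervalIntegral.integral_congr fun z _ => by rw [abs_mul, abs_pow, sq_abs]

/-! ### Registered helpers -/

/-- **Registered helper `t12_iterate_zonal_eq_iterate_circleAvg` — FF2: `j` zonal (far-field) steps as a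
`j`-fold iterated circle average.** For a unit vector `n` of `ℝ³`, a zonal weight `k : ℝ → ℝ` (measurable,
integrable on `[-1, 1]`), a profile `Y : ℝ³ → ℝ` (measurable, `|Y| ≤ m` on the unit sphere) and every `j`:
the `j`-th iterate at `n` of the zonal operator `(K F)(x) = ∫_{S²} k(⟪x, ω⟫) F(ω) dσ(ω)` equals the `j`-th iterate
at `n` of the cylindrical step `(C F)(x) = ∫_{-1}^{1} k(z) ∫_{-π}^{π} F(z x + √(1-z²)(cos φ e₁ x + sin φ e₂ x)) dφ dz`
`= 2π ∫_{-1}^{1} k(z) (A_z F)(x) dz` (frame `Lambert.e₁/e₂`), i.e.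
`(K^j Y)(n) = (2π)^j ∫⋯∫ Π_i k(z_i) (A_{z_1} ∘ ⋯ ∘ A_{z_j} Y)(n) dz₁⋯dz_j`: with `k = (2/π)x₊²` (the normalised
far-field step on the linear-growth class, `lorentzGain_smul_of_linear`; `iterate_farFieldStep_eq_iterate_circleAvg`)
this is plan §6 FF2's representation `∫⋯∫ Π 4ρ_i² dρ_i (A_{ρ_1}⋯A_{ρ_j} Y)(n)` of `j` far-field collisions, with
`k = (2/π)x₊` (direction-only data) the law `Π 4ρ_i dρ_i`. Induction on `j` over Funk–Hecke for circles
(`t12_funkHecke_circle`), the bounds `|K^j Y| ≤ (2π‖k‖₁)^j m` keeping every step integrable. [folklore] -/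
theorem t12_iterate_zonal_eq_iterate_circleAvg : ∀ n : EuclideanSpace ℝ (Fin 3), ‖n‖ = 1 → ∀ (k : ℝ → ℝ) (Y : EuclideanSpace ℝ (Fin 3) → ℝ) (m : ℝ), Measurable k → IntervalIntegrable k MeasureTheory.volume (-1) 1 → Measurable Y → (∀ x : EuclideanSpace ℝ (Fin 3), ‖x‖ = 1 → |Y x| ≤ m) → ∀ j : ℕ, Nat.iterate (fun (F : EuclideanSpace ℝ (Fin 3) → ℝ) (x : EuclideanSpace ℝ (Fin 3)) => ∫ ω : Metric.sphere (0 : EuclideanSpace ℝ (Fin 3)) 1, k (inner ℝ x (ω : EuclideanSpace ℝ (Fin 3))) * F (ω : EuclideanSpace ℝ (Fin 3)) ∂Literature.MathematicalPhysics.KineticTheory.sphereMeasure) j Y n = Nat.iterate (fun (F : EuclideanSpace ℝ (Fin 3) → ℝ) (x : EuclideanSpace ℝ (Fin 3)) => ∫ z in (-1 : ℝ)..1, k z * ∫ φ in (-Real.pi)..Real.pi, F (z • x + Real.sqrt (1 - z ^ 2) • (Real.cos φ • Literature.Analysis.FluidPDE.Lambert.e₁ x + Real.sin φ • Literature.Analysis.FluidPDE.Lambert.e₂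 x))) j Y n :=
  fun _ hn _ _ _ hk hkI hY hm j => iterate_sphere_zonal_eq_iterate_cyl hn hk hkI hY hm j

/-- **Registered helper `t12_iterate_zonal_legendre` — the Legendre coefficients of the `j`-fold zonal iterate
are the `j`-th powers of the one-step coefficients.** For unit vectors `n, n'` of `ℝ³`, a zonal weight `k`
(measurable, integrable on `[-1, 1]`) and every `ℓ, j`:
`(K^j P_ℓ(⟪n', ·⟫))(n) = (2π ∫_{-1}^{1} k(z) P_ℓ(z) dz)^j · P_ℓ(⟪n, n'⟫)`, `(K F)(x) = ∫_{S²} k(⟪x, ω⟫) F(ω) dσ(ω)` —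
the `j`-fold spherical convolution of a zonal kernel acts on the degree-`ℓ` zonal harmonics of any pole by
`λ_ℓ(k)^j`, `λ_ℓ(k) = 2π∫ k P_ℓ` its Legendre coefficient (FF4's "`Π_i P_ℓ(ρ_i)`" after averaging over the
radius-ratio laws; for `k = (2/π)x₊²`, `λ_ℓ = ∫₀¹4ρ²P_ℓ(ρ)dρ`, `|λ_ℓ| ≤ μ_ℓ` of `…T12Legendre`). Iterated Funk–Hecke
(`t12_funkHecke_legendre`). [folklore] -/
theorem t12_iterate_zonal_legendre : ∀ (ℓ j : ℕ) (n n' : EuclideanSpace ℝ (Fin 3)), ‖n‖ = 1 → ‖n'‖ = 1 → ∀ k : ℝ → ℝ, Measurable k → IntervalIntegrable k MeasureTheory.volume (-1) 1 → Nat.iterate (fun (F : EuclideanSpace ℝ (Fin 3) → ℝ) (x : EuclideanSpace ℝ (Fin 3)) => ∫ ω : Metric.sphere (0 : EuclideanSpace ℝ (Fin 3)) 1, k (inner ℝ x (ω : EuclideanSpace ℝ (Fin 3))) * F (ω : EuclideanSpace ℝ (Fin 3)) ∂Literature.MathematicalPhysics.KineticTheory.sphereMeasure) j (fun x : EuclideanSpace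 ℝ (Fin 3) => (Literature.Analysis.SpecialFunctions.legendre ℓ).eval (inner ℝ n' x)) n = (2 * Real.pi * ∫ z in (-1 : ℝ)..1, k z * (Literature.Analysis.SpecialFunctions.legendre ℓ).eval z) ^ j * (Literature.Analysis.SpecialFunctions.legendre ℓ).eval (inner ℝ n n') :=
  fun ℓ j _ _ hn hn' _ hk hkI => iterate_sphere_zonal_legendre ℓ hn' hk hkI j hn

end Summit.AtomisticToContinuum.HydrodynamicLimit.Theorems.ClampedCorrectorBirth

end
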